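import Summits.HubbardSuperconductivity.HubbardSuperconductivity.Theorems.AnisotropyChordTransferFibre3L2DeltaLocation

/-!
# Route `AnisotropyChord` / H0 rotor rung, LEVEL 2 (`∀ L ≥ 128`): GM₃ for `Δ ≤ 49/50` from a closed WEDGE of columns

Companion of `…L2DeltaLocation`.  For the block/final assembly over several `ν`-columns the `a`-height needed for `Δ ≤ 49/50` varies
with the column (`a ≤ 49·π²·ν`), so the closure statement of a block is taken on the WEDGE
`{ν ∈ [ν₁, ν₂], 0 ≤ a ≤ 49·(98697/10⁴)·ν}`: ★★ `gm3_of_closed_wedge` — if that wedge is closed and the ground profiles of `(L, Δ)`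
(`L ≥ 128`, `0 < Δ ≤ 49/50`) have `ν ∈ [ν₁, ν₂]`, then `GM3Fibre L Δ` (`a ≤ Δ/(1−Δ)·π²ν ≤ 49·9.8697·ν` by `a_le_of_delta_le`);
★ `wedge_of_col`: a column closed up to `a_top ≥ 49·(98697/10⁴)·ν₂` is closed on its part of the wedge; ★ `wedge_glue_nu`: two wedges
sharing a `ν`-edge glue.
Prover seat `hubbard-h0-rotor-p1` g31 (route lead); helper for piece A = stmt-HubbardSuperconductivity-23918 of rung 19089
(`--supports`, helper class).  Nothing here proves superconductivity in the Hubbard model; glue lemmas for ONE conditional reduction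
(the GM₃ ∀L certificate).  Tree imports only; no sorry.
-/

set_option linter.dupNamespace false
set_option autoImplicit false

namespace Summit.HubbardSuperconductivity.HubbardSuperconductivity.Theorems.AnisotropyChord.Transfer.Fibre3

namespace L2

variable (L : ℕ) [NeZero L]

omit [NeZero L] in
/-- ★ a column statement closed up to `a_top ≥ 49·(98697/10⁴)·ν₂` holds on the wedge part `a ≤ 49·(98697/10⁴)·ν` of the column. [folklore] -/
theorem wedge_of_col {lam2 Δ : ℝ} {f : Tor L → ℝ} {n1 n2 atop : ℝ} {P : Prop}
    (h : n1 ≤ lam2 / (2 * Real.pi / L) ^ 2 → lam2 / (2 * Real.pi / L) ^ 2 ≤ n2 → 0 ≤ Δ * f (K1 L) → Δ * f (K1 L) ≤ atop → P)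
    (htop : 49 * ((98697 : ℝ) / 10000) * n2 ≤ atop)
    (hν1 : n1 ≤ lam2 / (2 * Real.pi / L) ^ 2) (hν2 : lam2 / (2 * Real.pi / L) ^ 2 ≤ n2)
    (ha1 : 0 ≤ Δ * f (K1 L)) (ha2 : Δ * f (K1 L) ≤ 49 * ((98697 : ℝ) / 10000) * (lam2 / (2 * Real.pi / L) ^ 2)) : P :=
  h hν1 hν2 ha1 (ha2.trans ((mul_le_mul_of_nonneg_left hν2 (by norm_num)).trans htop))

omit [NeZero L] in
/-- ★ glueing two wedge statements `[ν₁, m]`, `[m, ν₂]` at `m`. [folklore] -/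
theorem wedge_glue_nu {lam2 Δ : ℝ} {f : Tor L → ℝ} {n1 m n2 : ℝ} {P : Prop}
    (h1 : n1 ≤ lam2 / (2 * Real.pi / L) ^ 2 → lam2 / (2 * Real.pi / L) ^ 2 ≤ m → 0 ≤ Δ * f (K1 L) →
      Δ * f (K1 L) ≤ 49 * ((98697 : ℝ) / 10000) * (lam2 / (2 * Real.pi / L) ^ 2) → P)
    (h2 : m ≤ lam2 / (2 * Real.pi / L) ^ 2 → lam2 / (2 * Real.pi / L) ^ 2 ≤ n2 → 0 ≤ Δ * f (K1 L) →
      Δ * f (K1 L) ≤ 49 * ((98697 : ℝ) / 10000) * (lam2 / (2 * Real.pi / L) ^ 2) → P)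
    (hν1 : n1 ≤ lam2 / (2 * Real.pi / L) ^ 2) (hν2 : lam2 / (2 * Real.pi / L) ^ 2 ≤ n2)
    (ha1 : 0 ≤ Δ * f (K1 L)) (ha2 : Δ * f (K1 L) ≤ 49 * ((98697 : ℝ) / 10000) * (lam2 / (2 * Real.pi / L) ^ 2)) : P := by
  rcases le_total (lam2 / (2 * Real.pi / L) ^ 2) m with h | h
  · exact h1 hν1 h ha1 ha2
  · exact h2 h hν2 ha1 ha2

/-- ★★ **GM₃ for `0 < Δ ≤ 49/50` from a closed wedge**: the closure statement on `{ν ∈ [ν₁, ν₂], 0 ≤ a ≤ 49·(98697/10⁴)·ν}` and the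
`ν`-location of the profiles of `(L, Δ)` (`L ≥ 128`) give `GM3Fibre L Δ`. [folklore] -/
theorem gm3_of_closed_wedge (hL : 128 ≤ L) {Δ : ℝ} (hΔ0 : 0 < Δ) (hΔ98 : Δ ≤ (49 : ℝ) / 50) (n1 n2 : ℝ)
    (hclosed : ∀ lam2 : ℝ, ∀ f : Tor L → ℝ, IsGroundTwoMagnon L Δ lam2 f →
      n1 ≤ lam2 / (2 * Real.pi / L) ^ 2 → lam2 / (2 * Real.pi / L) ^ 2 ≤ n2 → 0 ≤ Δ * f (K1 L) →
        Δ * f (K1 L) ≤ 49 * ((98697 : ℝ) / 10000) * (lam2 / (2 * Real.pi / L) ^ 2) →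
        ∃ c a b : ℝ,
          (0 ≤ mHole L Δ f ∧ facMI L Δ f * etaEff L lam2 * (a + b / (2 + Real.cos (2 * Real.pi / L))) < c) ∧
          c * Uunit L Δ f ≤ trialGapN1 L Δ f ∧
          lowGForm L Δ f ≤ a * etaEff L lam2 * Uunit L Δ f ∧
          (ip L (resid L Δ f) (resid L Δ f)).re - polePart L Δ f - lowNormPart L Δ f
            ≤ b * etaEff L lam2 * (2 * eps1 L - Tplus L Δ f) * Uunit L Δ f)
    (hν : ∀ lam2 : ℝ, ∀ f : Tor L → ℝ, IsGroundTwoMagnon L Δ lam2 f →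
      n1 ≤ lam2 / (2 * Real.pi / L) ^ 2 ∧ lam2 / (2 * Real.pi / L) ^ 2 ≤ n2) :
    GM3Fibre L Δ := by
  have hΔ1 : Δ < 1 := lt_of_le_of_lt hΔ98 (by norm_num)
  refine gm3_cellwise L (by omega) hΔ0 hΔ1 fun lam2 f hf _ _ => ?_
  obtain ⟨h1, h2⟩ := hν lam2 f hf
  obtain ⟨ha0, hν0, _⟩ := L2.N1.region_sides L hL hΔ0.le hΔ1 hf
  have hal := a_le_of_delta_le L (by omega) hΔ0.le hΔ1 hf hΔ98 (by norm_num)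
  have hπ2 : Real.pi ^ 2 < (98697 : ℝ) / 10000 := by nlinarith [Real.pi_lt_d6, Real.pi_pos]
  have htop : Δ * f (K1 L) ≤ 49 * ((98697 : ℝ) / 10000) * (lam2 / (2 * Real.pi / L) ^ 2) := by
    refine hal.trans ?_
    have : (49 : ℝ) / 50 / (1 - 49 / 50) = 49 := by norm_num
    rw [this]
    nlinarith [hν0]
  exact hclosed lam2 f hf h1 h2 ha0 htop

end L2

end Summit.HubbardSuperconductivity.HubbardSuperconductivity.Theorems.AnisotropyChord.Transfer.Fibre3
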